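import Mathlib.Analysis.SpecialFunctions.Pow.Real
import Mathlib.Tactic.Linarith
import Mathlib.Tactic.Positivity
import Mathlib.Tactic.Ring
import HarnessLib

/-!
# `NoHeavyLowerTail` (stmt-CriticalPhenomena-4575) — APL, geometric form: the composition lemma (algebraic core of the
# asymmetric star-closure theorem)

Support file (prover prim-ineq-gen-8 gen 29; `--supports stmt-CriticalPhenomena-4575`; memo
run/shared/lean/prim/prim-ineq-gen-8/FINDING-gen29-APL-GEOMETRIC.md §2).  Pure real algebra, no named facts, no sorries.

CONTEXT.  For three vertices `a, b, c` of a finite weighted graph write `u_ab = P(ab|c)`, `u_ac = P(ac|b)`,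
`e = u_ab + u_ac`, `D = P(b ↮ c)`, `T = P(a ↔ b ∪ a ↔ c)`.  The lineage's conjectured reverse-Harris row APL(2/3)
(`3e ≥ 2·D·T`, prove-5 g35/g37; siblings `…APLTriRegime`, `…APLLightTargets*`, `…APLSwitching`) is implied by the
GEOMETRIC form  APL-G: `T·D − e ≤ sqrt(u_ab · u_ac)` (AM–GM), and coincides with it when `u_ab = u_ac`.  In terms of the
normalised gadget triple `(qB, qC, r) = (u_ab/D, u_ac/D, T)`, APL-G says
`(qB, qC, r) ∈ Γ := {qB, qC ≥ 0, qB + qC ≤ r ≤ 1, (r − qB − qC)² ≤ qB·qC}`.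
When `{a,b,c}` separates the graph into pieces, the triple of the whole graph is the COMPOSITE of the piece triples:
  `A_B = Π(1−qB_i), A_C = Π(1−qC_i), A_0 = Π(1−qB_i−qC_i), N_0 = Π(1−r_i);`
  `qB' = (A_C−A_0)/D', qC' = (A_B−A_0)/D', r' = 1 − N_0, D' = A_B + A_C − A_0`
(memo §1; prove-5 g35 §4 for symmetric one-root gadgets).  THEOREM A of the memo: `Γ` is closed under this composition —
whereas the plain APL(2/3) region is not (g35: 0.653) — hence APL-G (and APL(2/3), sharp) holds on every weighted graph
with `G ∖ {b,c}` a forest and is preserved under piece-union at the apex.  Composition is associative and commutes with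
rescaling, so the two-factor case is the whole algebraic content; this file proves its hard direction in the boundary
(square-root) coordinates `x₁ = σ², y₁ = τ², r₁ = σ²+τ²+στ`, `x₂ = s², y₂ = t², r₂ = s²+t²+st`, to which the general case
reduces by monotonicity (memo §2 (i)–(ii)).  With `E_B := A_C − A_0 = σ² + s² − σ²s² − P`, `E_C := A_B − A_0`,
`P := σ²t² + s²τ²`, `M := r'D' − E_B − E_C = (1−σ²−τ²)(1−s²−t²) − (1−r₁)(1−r₂)(1−P)`:
* `geom_compose_identity` — `E_B·E_C − M² = T₁ + T₂ + T₃ − (X − Y)²` (Lagrange's identity for the Cauchy–Schwarz pairing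
  `u = (σ√(1−A), s√(1−B), σs)`, `v = (τ√(1−A), t√(1−B), τt)`, `A = s²+t²`, `B = σ²+τ²`);
* `geom_compose_coeff_nonneg` — LEMMA F: the coefficient of `δ = (sτ − tσ)²` in `T₁ − Y²` is `≥ 0`;
* `geom_compose_core` — `M² ≤ E_B · E_C`, i.e. `(r' − qB' − qC')² ≤ qB'·qC'` for the composite.
[folklore algebra; the percolation meaning and the reduction are in the memo]
-/

namespace Summit.CriticalPhenomena.PercolationContinuityZ3.Theorems

namespace APL

set_option maxHeartbeats 4000000 in
/-- The polynomial identity behind `geom_compose_core` (Lagrange's identity for a three-term Cauchy–Schwarz pairing,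
with `X = 2pq(1 − n₁n₂)`, `Y = δ·n₁n₂`). [folklore] -/
theorem geom_compose_identity (σ τ s t : ℝ) :
    (σ^2 + s^2 - σ^2*s^2 - (σ^2*t^2 + s^2*τ^2)) * (τ^2 + t^2 - τ^2*t^2 - (σ^2*t^2 + s^2*τ^2)) - ((1 - σ^2 - τ^2)*(1 - s^2 - t^2) - (1 - σ^2 - τ^2 - σ*τ)*(1 - s^2 - t^2 - s*t)*(1 - (σ^2*t^2 + s^2*τ^2)))^2
      = (((s*τ - t*σ)^2)*(((1 - (s^2 + t^2))*(1 - (σ^2 + τ^2))) - 2*((σ*τ)*(1 - (s^2 + t^2)) + (s*t)*(1 - (σ^2 + τ^2)) + (s*t)*(σ*τ))*(1 - σ^2 - τ^2 - σ*τ)*(1 - s^2 - t^2 - s*t))) + (4*(s*t)*(σ*τ)*(1 - (1 - σ^2 - τ^2 - σ*τ)*(1 - s^2 - t^2 - s*t))*((σ*τ)*(1 - (s^2 + t^2)) + (s*t)*(1 - (σ^2 + τ^2)) + (s*t)*(σ*τ))) + ((σ*τ)^2*(1 - (s^2 + t^2))*(t - s)^2 + (s*t)^2*(1 - (σ^2 +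 τ^2))*(τ - σ)^2) - ((2*(s*t)*(σ*τ)*(1 - (1 - σ^2 - τ^2 - σ*τ)*(1 - s^2 - t^2 - s*t))) - (((s*τ - t*σ)^2)*(1 - σ^2 - τ^2 - σ*τ)*(1 - s^2 - t^2 - s*t)))^2 := by
  ring

/-- Abstract bookkeeping: `T₂ ≥ X²`. [folklore] -/
theorem geom_compose_stepT2 (p q m uv : ℝ) (hp : 0 ≤ p) (hq : 0 ≤ q) (hm : 0 ≤ m) (h : 0 ≤ uv - p*q*m) :
    (2*p*q*m)^2 ≤ 4*p*q*m*uv := by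
  have h1 : 0 ≤ p*q*m*(uv - p*q*m) := mul_nonneg (mul_nonneg (mul_nonneg hp hq) hm) h
  nlinarith [h1]

/-- Abstract bookkeeping: `T₁ ≥ Y²` given LEMMA F. [folklore] -/
theorem geom_compose_stepT1 (δ c uv n₁ n₂ : ℝ) (hδ : 0 ≤ δ) (hf : 0 ≤ c - 2*uv*n₁*n₂ - δ*n₁^2*n₂^2) :
    (δ*n₁*n₂)^2 ≤ δ*(c - 2*uv*n₁*n₂) := by
  have h1 : 0 ≤ δ*(c - 2*uv*n₁*n₂ - δ*n₁^2*n₂^2) := mul_nonneg hδ hf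
  nlinarith [h1]

/-- Abstract bookkeeping: the final combination `E_B E_C − M² = T₁ + T₂ + T₃ − (X−Y)² ≥ 0`. [folklore] -/
theorem geom_compose_combine {L M2 T₁ T₂ T₃ X Y : ℝ} (key : L - M2 = T₁ + T₂ + T₃ - (X - Y)^2)
    (h1 : Y^2 ≤ T₁) (h2 : X^2 ≤ T₂) (h3 : 0 ≤ T₃) (hX : 0 ≤ X) (hY : 0 ≤ Y) : M2 ≤ L := by
  nlinarith [mul_nonneg hX hY]

/-- LEMMA F of the memo: with `a' = 1 − s² − t²`, `b' = 1 − σ² − τ²`, `n₁ = b' − στ`, `n₂ = a' − st`,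
`⟨u,v⟩ = στ·a' + st·b' + st·στ` and `δ = (sτ − tσ)²`, one has `a'b' − 2⟨u,v⟩n₁n₂ − δ n₁²n₂² ≥ 0`
(product bounds `n₁·στ ≤ b'(1−b')/2`, `n₂·st ≤ a'(1−a')/2`, `δ ≤ (1−a')(1−b')`, then
`a'b'·[(1−a')(1−b')/2 + a'b'(1 − (1−a')(1−b'))] ≥ 0`). [folklore] -/
theorem geom_compose_coeff_nonneg (σ τ s t : ℝ) (hσ : 0 ≤ σ) (hτ : 0 ≤ τ) (hs : 0 ≤ s) (ht : 0 ≤ t)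
    (hn₁ : 0 ≤ 1 - σ^2 - τ^2 - σ*τ) (hn₂ : 0 ≤ 1 - s^2 - t^2 - s*t) :
    0 ≤ (((1 - (s^2 + t^2))*(1 - (σ^2 + τ^2))) - 2*((σ*τ)*(1 - (s^2 + t^2)) + (s*t)*(1 - (σ^2 + τ^2)) + (s*t)*(σ*τ))*(1 - σ^2 - τ^2 - σ*τ)*(1 - s^2 - t^2 - s*t) - ((s*τ - t*σ)^2)*(1 - σ^2 - τ^2 - σ*τ)^2*(1 - s^2 - t^2 - s*t)^2) := by
  have hq : 0 ≤ σ*τ := mul_nonneg hσ hτ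
  have hp : 0 ≤ s*t := mul_nonneg hs ht
  have hA0 : 0 ≤ (s^2 + t^2) := by positivity
  have hB0 : 0 ≤ (σ^2 + τ^2) := by positivity
  have ha : 0 ≤ (1 - (s^2 + t^2)) := by linarith
  have hb : 0 ≤ (1 - (σ^2 + τ^2)) := by linarith
  have hA1 : (s^2 + t^2) ≤ 1 := by linarith
  have hB1 : (σ^2 + τ^2) ≤ 1 := by linarith
  have hn2a : (1 - s^2 - t^2 - s*t) ≤ (1 - (s^2 + t^2)) := by linarith
  have hn1b : (1 - σ^2 - τ^2 - σ*τ) ≤ (1 - (σ^2 + τ^2)) := by linarith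
  have hqB : σ*τ ≤ (σ^2 + τ^2)/2 := by nlinarith [sq_nonneg (σ - τ)]
  have hpA : s*t ≤ (s^2 + t^2)/2 := by nlinarith [sq_nonneg (s - t)]
  have hδ0 : 0 ≤ ((s*τ - t*σ)^2) := sq_nonneg _
  have hδ : ((s*τ - t*σ)^2) ≤ (s^2 + t^2)*(σ^2 + τ^2) := by nlinarith [sq_nonneg (s*σ + t*τ)]
  have b1 : (1 - σ^2 - τ^2 - σ*τ)*(σ*τ) ≤ (1 - (σ^2 + τ^2))*((σ^2 + τ^2)/2) := mul_le_mul hn1b hqB hq hb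
  have b2 : (1 - s^2 - t^2 - s*t)*(s*t) ≤ (1 - (s^2 + t^2))*((s^2 + t^2)/2) := mul_le_mul hn2a hpA hp ha
  have hn1q : 0 ≤ (1 - σ^2 - τ^2 - σ*τ)*(σ*τ) := mul_nonneg hn₁ hq
  have hn2p : 0 ≤ (1 - s^2 - t^2 - s*t)*(s*t) := mul_nonneg hn₂ hp
  have hbB : 0 ≤ (1 - (σ^2 + τ^2))*((σ^2 + τ^2)/2) := by positivity
  have c1 : (1 - s^2 - t^2 - s*t)*((1 - σ^2 - τ^2 - σ*τ)*(σ*τ)) ≤ (1 - (s^2 + t^2))*((1 - (σ^2 + τ^2))*((σ^2 + τ^2)/2)) := mul_le_mul hn2a b1 hn1q ha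
  have c1' : (1 - (s^2 + t^2))*((1 - s^2 - t^2 - s*t)*((1 - σ^2 - τ^2 - σ*τ)*(σ*τ))) ≤ (1 - (s^2 + t^2))*((1 - (s^2 + t^2))*((1 - (σ^2 + τ^2))*((σ^2 + τ^2)/2))) :=
    mul_le_mul_of_nonneg_left c1 ha
  have c2 : (1 - σ^2 - τ^2 - σ*τ)*((1 - s^2 - t^2 - s*t)*(s*t)) ≤ (1 - (σ^2 + τ^2))*((1 - (s^2 + t^2))*((s^2 + t^2)/2)) := mul_le_mul hn1b b2 hn2p hb
  have c2' : (1 - (σ^2 + τ^2))*((1 - σ^2 - τ^2 - σ*τ)*((1 - s^2 - t^2 - s*t)*(s*t))) ≤ (1 - (σ^2 + τ^2))*((1 - (σ^2 + τ^2))*((1 - (s^2 + t^2))*((s^2 + t^2)/2))) :=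
    mul_le_mul_of_nonneg_left c2 hb
  have c3 : ((1 - σ^2 - τ^2 - σ*τ)*(σ*τ))*((1 - s^2 - t^2 - s*t)*(s*t)) ≤ ((1 - (σ^2 + τ^2))*((σ^2 + τ^2)/2))*((1 - (s^2 + t^2))*((s^2 + t^2)/2)) := mul_le_mul b1 b2 hn2p hbB
  have hn1sq : (1 - σ^2 - τ^2 - σ*τ)^2 ≤ (1 - (σ^2 + τ^2))^2 := pow_le_pow_left₀ hn₁ hn1b 2
  have hn2sq : (1 - s^2 - t^2 - s*t)^2 ≤ (1 - (s^2 + t^2))^2 := pow_le_pow_left₀ hn₂ hn2a 2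
  have c4a : ((s*τ - t*σ)^2)*(1 - σ^2 - τ^2 - σ*τ)^2 ≤ ((s^2 + t^2)*(σ^2 + τ^2))*(1 - (σ^2 + τ^2))^2 := mul_le_mul hδ hn1sq (sq_nonneg _) (mul_nonneg hA0 hB0)
  have c4 : ((s*τ - t*σ)^2)*(1 - σ^2 - τ^2 - σ*τ)^2*(1 - s^2 - t^2 - s*t)^2 ≤ ((s^2 + t^2)*(σ^2 + τ^2))*(1 - (σ^2 + τ^2))^2*(1 - (s^2 + t^2))^2 :=
    mul_le_mul c4a hn2sq (sq_nonneg _) (by positivity)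
  have hAB1 : (s^2 + t^2)*(σ^2 + τ^2) ≤ 1 := mul_le_one₀ hA1 hB0 hB1
  have hh1 : 0 ≤ (1 - (s^2 + t^2))*(1 - (σ^2 + τ^2))*((s^2 + t^2)*(σ^2 + τ^2)/2) := by positivity
  have hh2 : 0 ≤ ((1 - (s^2 + t^2))*(1 - (σ^2 + τ^2)))^2*(1 - (s^2 + t^2)*(σ^2 + τ^2)) := mul_nonneg (sq_nonneg _) (by linarith)
  have euv : 2*((σ*τ)*(1 - (s^2 + t^2)) + (s*t)*(1 - (σ^2 + τ^2)) + (s*t)*(σ*τ))*(1 - σ^2 - τ^2 - σ*τ)*(1 - s^2 - t^2 - s*t)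
      = 2*((1 - (s^2 + t^2))*((1 - s^2 - t^2 - s*t)*((1 - σ^2 - τ^2 - σ*τ)*(σ*τ)))) + 2*((1 - (σ^2 + τ^2))*((1 - σ^2 - τ^2 - σ*τ)*((1 - s^2 - t^2 - s*t)*(s*t)))) + 2*(((1 - σ^2 - τ^2 - σ*τ)*(σ*τ))*((1 - s^2 - t^2 - s*t)*(s*t))) := by
    ring
  have eh : ((1 - (s^2 + t^2))*(1 - (σ^2 + τ^2))) - (2*((1 - (s^2 + t^2))*((1 - (s^2 + t^2))*((1 - (σ^2 + τ^2))*((σ^2 + τ^2)/2)))) + 2*((1 - (σ^2 + τ^2))*((1 - (σ^2 + τ^2))*((1 - (s^2 + t^2))*((s^2 + t^2)/2))))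
      + 2*(((1 - (σ^2 + τ^2))*((σ^2 + τ^2)/2))*((1 - (s^2 + t^2))*((s^2 + t^2)/2)))) - ((s^2 + t^2)*(σ^2 + τ^2))*(1 - (σ^2 + τ^2))^2*(1 - (s^2 + t^2))^2
      = (1 - (s^2 + t^2))*(1 - (σ^2 + τ^2))*((s^2 + t^2)*(σ^2 + τ^2)/2) + ((1 - (s^2 + t^2))*(1 - (σ^2 + τ^2)))^2*(1 - (s^2 + t^2)*(σ^2 + τ^2)) := by
    ring
  linarith [euv, eh, c1', c2', c3, c4, hh1, hh2]

/-- Boundary case of the composition lemma in square-root coordinates (memo §2, K2 case (ii)): for `σ,τ,s,t ≥ 0` with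
`σ² + τ² + στ ≤ 1` and `s² + t² + st ≤ 1` (two gadgets on the curved boundary of `Γ`), the composite satisfies
`M² ≤ E_B·E_C`, i.e. `(r' − qB' − qC')² ≤ qB'·qC'`. [folklore] -/
theorem geom_compose_core (σ τ s t : ℝ) (hσ : 0 ≤ σ) (hτ : 0 ≤ τ) (hs : 0 ≤ s) (ht : 0 ≤ t)
    (hn₁ : 0 ≤ 1 - σ^2 - τ^2 - σ*τ) (hn₂ : 0 ≤ 1 - s^2 - t^2 - s*t) :
    ((1 - σ^2 - τ^2)*(1 - s^2 - t^2) - (1 - σ^2 - τ^2 - σ*τ)*(1 - s^2 - t^2 - s*t)*(1 - (σ^2*t^2 + s^2*τ^2)))^2 ≤ (σ^2 + s^2 - σ^2*s^2 - (σ^2*t^2 + s^2*τ^2)) * (τ^2 + t^2 - τ^2*t^2 - (σ^2*t^2 + s^2*τ^2)) := by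
  have hq : 0 ≤ σ*τ := mul_nonneg hσ hτ
  have hp : 0 ≤ s*t := mul_nonneg hs ht
  have ha : 0 ≤ (1 - (s^2 + t^2)) := by linarith
  have hb : 0 ≤ (1 - (σ^2 + τ^2)) := by linarith
  have hn1le : (1 - σ^2 - τ^2 - σ*τ) ≤ 1 := by nlinarith [sq_nonneg σ, sq_nonneg τ]
  have hn2le : (1 - s^2 - t^2 - s*t) ≤ 1 := by nlinarith [sq_nonneg s, sq_nonneg t]
  have hn12 : 0 ≤ (1 - σ^2 - τ^2 - σ*τ)*(1 - s^2 - t^2 - s*t) := mul_nonneg hn₁ hn₂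
  have hn12le : (1 - σ^2 - τ^2 - σ*τ)*(1 - s^2 - t^2 - s*t) ≤ 1 := mul_le_one₀ hn1le hn₂ hn2le
  have hm : 0 ≤ (1 - (1 - σ^2 - τ^2 - σ*τ)*(1 - s^2 - t^2 - s*t)) := by linarith
  have hδ0 : 0 ≤ ((s*τ - t*σ)^2) := sq_nonneg _
  have huv' : 0 ≤ ((σ*τ)*(1 - (s^2 + t^2)) + (s*t)*(1 - (σ^2 + τ^2)) + (s*t)*(σ*τ)) - (s*t)*(σ*τ)*(1 - (1 - σ^2 - τ^2 - σ*τ)*(1 - s^2 - t^2 - s*t)) := by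
    have h1 := mul_nonneg hq ha
    have h2 := mul_nonneg hp hb
    have h3 := mul_nonneg (mul_nonneg hp hq) hn12
    nlinarith [h1, h2, h3]
  have hX : 0 ≤ (2*(s*t)*(σ*τ)*(1 - (1 - σ^2 - τ^2 - σ*τ)*(1 - s^2 - t^2 - s*t))) := by
    have := mul_nonneg (mul_nonneg hp hq) hm
    linarith
  have hY : 0 ≤ (((s*τ - t*σ)^2)*(1 - σ^2 - τ^2 - σ*τ)*(1 - s^2 - t^2 - s*t)) := mul_nonneg (mul_nonneg hδ0 hn₁) hn₂
  have hT2 : (2*(s*t)*(σ*τ)*(1 - (1 - σ^2 - τ^2 - σ*τ)*(1 - s^2 - t^2 - s*t)))^2 ≤ (4*(s*t)*(σ*τ)*(1 - (1 - σ^2 - τ^2 - σ*τ)*(1 - s^2 - t^2 - s*t))*((σ*τ)*(1 - (s^2 + t^2)) + (s*t)*(1 - (σ^2 + τ^2)) + (s*t)*(σ*τ))) := geom_compose_stepT2 (s*t) (σ*τ) (1 - (1 - σ^2 - τ^2 - σ*τ)*(1 - s^2 - t^2 - s*t)) ((σ*τ)*(1 - (s^2 + t^2)) + (s*t)*(1 -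 (σ^2 + τ^2)) + (s*t)*(σ*τ)) hp hq hm huv'
  have hT3 : 0 ≤ ((σ*τ)^2*(1 - (s^2 + t^2))*(t - s)^2 + (s*t)^2*(1 - (σ^2 + τ^2))*(τ - σ)^2) := by
    have h1 : 0 ≤ (σ*τ)^2*(1 - (s^2 + t^2))*(t - s)^2 := mul_nonneg (mul_nonneg (sq_nonneg _) ha) (sq_nonneg _)
    have h2 : 0 ≤ (s*t)^2*(1 - (σ^2 + τ^2))*(τ - σ)^2 := mul_nonneg (mul_nonneg (sq_nonneg _) hb) (sq_nonneg _)
    linarith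
  have hf := geom_compose_coeff_nonneg σ τ s t hσ hτ hs ht hn₁ hn₂
  have hT1 : (((s*τ - t*σ)^2)*(1 - σ^2 - τ^2 - σ*τ)*(1 - s^2 - t^2 - s*t))^2 ≤ (((s*τ - t*σ)^2)*(((1 - (s^2 + t^2))*(1 - (σ^2 + τ^2))) - 2*((σ*τ)*(1 - (s^2 + t^2)) + (s*t)*(1 - (σ^2 + τ^2)) + (s*t)*(σ*τ))*(1 - σ^2 - τ^2 - σ*τ)*(1 - s^2 - t^2 - s*t))) := geom_compose_stepT1 ((s*τ - t*σ)^2) ((1 - (s^2 + t^2))*(1 - (σ^2 + τ^2))) ((σ*τ)*(1 - (s^2 + t^2)) + (s*t)*(1 - (σ^2 + τ^2)) + (s*t)*(σ*τ)) (1 - σ^2 - τ^2 - σ*τ) (1 - s^2 - t^2 - s*t) hδ0 hf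
  exact geom_compose_combine (geom_compose_identity σ τ s t) hT1 hT2 hT3 hX hY


/-! ### The composition lemma in gadget coordinates `(x_i, y_i, r_i) = (qB_i, qC_i, r_i) ∈ Γ`

For two factors the composite has `D' = A_B + A_C − A_0 = 1 − P` with `P = x₁y₂ + x₂y₁`,
`E_B := A_C − A_0 = x₁ + x₂ − x₁x₂ − P` (`= qB'·D'`), `E_C := A_B − A_0 = y₁ + y₂ − y₁y₂ − P` (`= qC'·D'`),
`r' = 1 − (1−r₁)(1−r₂)`, and `r'D' − E_B − E_C = (1−x₁−y₁)(1−x₂−y₂) − (1−r₁)(1−r₂)(1−P)` (`= (r' − qB' − qC')·D'`). -/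

/-- Bookkeeping identities for the two-factor composite: `A_C − A_0 = E_B`, `A_B − A_0 = E_C`, `D' = 1 − P` and
`r'·D' − E_B − E_C = (1−x₁−y₁)(1−x₂−y₂) − (1−r₁)(1−r₂)(1−P)`. [folklore] -/
theorem geom_compose_cells (x₁ y₁ r₁ x₂ y₂ r₂ : ℝ) :
    (1 - y₁) * (1 - y₂) - (1 - x₁ - y₁) * (1 - x₂ - y₂) = (x₁ + x₂ - x₁ * x₂ - (x₁ * y₂ + x₂ * y₁)) ∧
    (1 - x₁) * (1 - x₂) - (1 - x₁ - y₁) * (1 - x₂ - y₂) = (y₁ + y₂ - y₁ * y₂ - (x₁ * y₂ + x₂ * y₁)) ∧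
    (1 - x₁) * (1 - x₂) + (1 - y₁) * (1 - y₂) - (1 - x₁ - y₁) * (1 - x₂ - y₂) = 1 - (x₁ * y₂ + x₂ * y₁) ∧
    (1 - (1 - r₁) * (1 - r₂)) * (1 - (x₁ * y₂ + x₂ * y₁)) - (x₁ + x₂ - x₁ * x₂ - (x₁ * y₂ + x₂ * y₁)) - (y₁ + y₂ - y₁ * y₂ - (x₁ * y₂ + x₂ * y₁)) = ((1 - x₁ - y₁) * (1 - x₂ - y₂) - (1 - r₁) * (1 - r₂) * (1 - (x₁ * y₂ + x₂ * y₁))) := by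
  refine ⟨by ring, by ring, by ring, by ring⟩

/-- `Γ`-membership of the composite, easy parts: `E_B ≥ 0`, `E_C ≥ 0`, `D' ≥ 0`, and the Harris direction
`qB' + qC' ≤ r'`, i.e. `0 ≤ r'D' − E_B − E_C`. [folklore] -/
theorem geom_compose_easy (x₁ y₁ r₁ x₂ y₂ r₂ : ℝ)
    (hx₁ : 0 ≤ x₁) (hy₁ : 0 ≤ y₁) (hl₁ : x₁ + y₁ ≤ r₁) (hr₁ : r₁ ≤ 1)
    (hx₂ : 0 ≤ x₂) (hy₂ : 0 ≤ y₂) (hl₂ : x₂ + y₂ ≤ r₂) (hr₂ : r₂ ≤ 1) :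
    0 ≤ (x₁ + x₂ - x₁ * x₂ - (x₁ * y₂ + x₂ * y₁)) ∧ 0 ≤ (y₁ + y₂ - y₁ * y₂ - (x₁ * y₂ + x₂ * y₁)) ∧ 0 ≤ 1 - (x₁ * y₂ + x₂ * y₁) ∧ 0 ≤ ((1 - x₁ - y₁) * (1 - x₂ - y₂) - (1 - r₁) * (1 - r₂) * (1 - (x₁ * y₂ + x₂ * y₁))) := by
  have hw₁ : 0 ≤ 1 - x₁ - y₁ := by linarith
  have hw₂ : 0 ≤ 1 - x₂ - y₂ := by linarith
  have hn₁ : 0 ≤ 1 - r₁ := by linarith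
  have hn₂ : 0 ≤ 1 - r₂ := by linarith
  have hx₂1 : x₂ ≤ 1 := by linarith
  have hy₂1 : y₂ ≤ 1 := by linarith
  have hP1 : (x₁ * y₂ + x₂ * y₁) ≤ 1 := by
    have h1 : x₁ * y₂ ≤ x₁ := mul_le_of_le_one_right hx₁ hy₂1
    have h2 : x₂ * y₁ ≤ y₁ := mul_le_of_le_one_left hy₁ hx₂1
    linarith
  have hP0 : 0 ≤ (x₁ * y₂ + x₂ * y₁) := by positivity
  refine ⟨?_, ?_, by linarith, ?_⟩
  · have e : (x₁ + x₂ - x₁ * x₂ - (x₁ * y₂ + x₂ * y₁)) = x₁ * (1 - x₂ - y₂) + x₂ * (1 - x₁ - y₁) + x₁ * x₂ := by ring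
    rw [e]; positivity
  · have e : (y₁ + y₂ - y₁ * y₂ - (x₁ * y₂ + x₂ * y₁)) = y₁ * (1 - x₂ - y₂) + y₂ * (1 - x₁ - y₁) + y₁ * y₂ := by ring
    rw [e]; positivity
  · have h1 : (1 - r₁) * (1 - r₂) ≤ (1 - x₁ - y₁) * (1 - x₂ - y₂) :=
      mul_le_mul (by linarith) (by linarith) hn₂ hw₁
    have h2 : (1 - r₁) * (1 - r₂) * (1 - (x₁ * y₂ + x₂ * y₁)) ≤ (1 - r₁) * (1 - r₂) :=
      mul_le_of_le_one_right (mul_nonneg hn₁ hn₂) (by linarith)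
    linarith

/-- THE COMPOSITION LEMMA (memo §2, K2): if `(x_i, y_i, r_i) ∈ Γ` for `i = 1, 2` then the composite satisfies
`(r'D' − E_B − E_C)² ≤ E_B·E_C`, i.e. `(r' − qB' − qC')² ≤ qB'·qC'`; together with `geom_compose_easy` this is
`(qB', qC', r') ∈ Γ`.  Reduction to `geom_compose_core`: `M` is non-increasing in `1 − r_i`, so `r_i − x_i − y_i` may be
raised to `min(sqrt(x_i y_i), 1 − x_i − y_i)`; if the `min` is `1 − x_i − y_i` for some `i` the claim is
`M ≤ (1−x₁−y₁)(1−x₂−y₂)` and `E_B E_C ≥ x_i y_i (1−x_j−y_j)²`; otherwise substitute `x₁ = σ²`, …, `r_i − x_i − y_i = στ, st`.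
[folklore] -/
theorem geom_compose_sq (x₁ y₁ r₁ x₂ y₂ r₂ : ℝ)
    (hx₁ : 0 ≤ x₁) (hy₁ : 0 ≤ y₁) (hl₁ : x₁ + y₁ ≤ r₁) (hr₁ : r₁ ≤ 1) (hg₁ : (r₁ - x₁ - y₁)^2 ≤ x₁ * y₁)
    (hx₂ : 0 ≤ x₂) (hy₂ : 0 ≤ y₂) (hl₂ : x₂ + y₂ ≤ r₂) (hr₂ : r₂ ≤ 1) (hg₂ : (r₂ - x₂ - y₂)^2 ≤ x₂ * y₂) :
    ((1 - x₁ - y₁) * (1 - x₂ - y₂) - (1 - r₁) * (1 - r₂) * (1 - (x₁ * y₂ + x₂ * y₁)))^2 ≤ (x₁ + x₂ - x₁ * x₂ - (x₁ * y₂ + x₂ * y₁)) * (y₁ + y₂ - y₁ * y₂ - (x₁ * y₂ + x₂ * y₁)) := by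
  obtain ⟨hEB0, hEC0, hP0', hM0⟩ := geom_compose_easy x₁ y₁ r₁ x₂ y₂ r₂ hx₁ hy₁ hl₁ hr₁ hx₂ hy₂ hl₂ hr₂
  have hw₁ : 0 ≤ 1 - x₁ - y₁ := by linarith
  have hw₂ : 0 ≤ 1 - x₂ - y₂ := by linarith
  have hn₁ : 0 ≤ 1 - r₁ := by linarith
  have hn₂ : 0 ≤ 1 - r₂ := by linarith
  have hP0 : 0 ≤ (x₁ * y₂ + x₂ * y₁) := by positivity
  have hMle : ((1 - x₁ - y₁) * (1 - x₂ - y₂) - (1 - r₁) * (1 - r₂) * (1 - (x₁ * y₂ + x₂ * y₁))) ≤ (1 - x₁ - y₁) * (1 - x₂ - y₂) := by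
    have := mul_nonneg (mul_nonneg hn₁ hn₂) hP0'
    linarith
  have hEB1 : x₁ * (1 - x₂ - y₂) ≤ (x₁ + x₂ - x₁ * x₂ - (x₁ * y₂ + x₂ * y₁)) := by
    have := mul_nonneg hx₂ hw₁; have := mul_nonneg hx₁ hx₂; nlinarith
  have hEC1 : y₁ * (1 - x₂ - y₂) ≤ (y₁ + y₂ - y₁ * y₂ - (x₁ * y₂ + x₂ * y₁)) := by
    have := mul_nonneg hy₂ hw₁; have := mul_nonneg hy₁ hy₂; nlinarith
  have hEB2 : x₂ * (1 - x₁ - y₁) ≤ (x₁ + x₂ - x₁ * x₂ - (x₁ * y₂ + x₂ * y₁)) := by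
    have := mul_nonneg hx₁ hw₂; have := mul_nonneg hx₁ hx₂; nlinarith
  have hEC2 : y₂ * (1 - x₁ - y₁) ≤ (y₁ + y₂ - y₁ * y₂ - (x₁ * y₂ + x₂ * y₁)) := by
    have := mul_nonneg hy₁ hw₂; have := mul_nonneg hy₁ hy₂; nlinarith
  have hMsq : ((1 - x₁ - y₁) * (1 - x₂ - y₂) - (1 - r₁) * (1 - r₂) * (1 - (x₁ * y₂ + x₂ * y₁)))^2 ≤ ((1 - x₁ - y₁) * (1 - x₂ - y₂))^2 := pow_le_pow_left₀ hM0 hMle 2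
  by_cases h1 : (1 - x₁ - y₁)^2 ≤ x₁ * y₁
  · -- case (i), first factor capped
    calc ((1 - x₁ - y₁) * (1 - x₂ - y₂) - (1 - r₁) * (1 - r₂) * (1 - (x₁ * y₂ + x₂ * y₁)))^2 ≤ ((1 - x₁ - y₁) * (1 - x₂ - y₂))^2 := hMsq
      _ = (1 - x₁ - y₁)^2 * (1 - x₂ - y₂)^2 := by ring
      _ ≤ (x₁ * y₁) * (1 - x₂ - y₂)^2 := mul_le_mul_of_nonneg_right h1 (sq_nonneg _)
      _ = (x₁ * (1 - x₂ - y₂)) * (y₁ * (1 - x₂ - y₂)) := by ring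
      _ ≤ (x₁ + x₂ - x₁ * x₂ - (x₁ * y₂ + x₂ * y₁)) * (y₁ + y₂ - y₁ * y₂ - (x₁ * y₂ + x₂ * y₁)) := mul_le_mul hEB1 hEC1 (mul_nonneg hy₁ hw₂) hEB0
  · by_cases h2 : (1 - x₂ - y₂)^2 ≤ x₂ * y₂
    · -- case (i), second factor capped
      calc ((1 - x₁ - y₁) * (1 - x₂ - y₂) - (1 - r₁) * (1 - r₂) * (1 - (x₁ * y₂ + x₂ * y₁)))^2 ≤ ((1 - x₁ - y₁) * (1 - x₂ - y₂))^2 := hMsq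
        _ = (1 - x₂ - y₂)^2 * (1 - x₁ - y₁)^2 := by ring
        _ ≤ (x₂ * y₂) * (1 - x₁ - y₁)^2 := mul_le_mul_of_nonneg_right h2 (sq_nonneg _)
        _ = (x₂ * (1 - x₁ - y₁)) * (y₂ * (1 - x₁ - y₁)) := by ring
        _ ≤ (x₁ + x₂ - x₁ * x₂ - (x₁ * y₂ + x₂ * y₁)) * (y₁ + y₂ - y₁ * y₂ - (x₁ * y₂ + x₂ * y₁)) := mul_le_mul hEB2 hEC2 (mul_nonneg hy₂ hw₁) hEB0
    · -- case (ii): square-root coordinates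
      push Not at h1 h2
      set σ := Real.sqrt x₁ with hσdef
      set τ := Real.sqrt y₁ with hτdef
      set s := Real.sqrt x₂ with hsdef
      set t := Real.sqrt y₂ with htdef
      have hσ : 0 ≤ σ := Real.sqrt_nonneg _
      have hτ : 0 ≤ τ := Real.sqrt_nonneg _
      have hs : 0 ≤ s := Real.sqrt_nonneg _
      have ht : 0 ≤ t := Real.sqrt_nonneg _
      have hσ2 : σ^2 = x₁ := Real.sq_sqrt hx₁
      have hτ2 : τ^2 = y₁ := Real.sq_sqrt hy₁
      have hs2 : s^2 = x₂ := Real.sq_sqrt hx₂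
      have ht2 : t^2 = y₂ := Real.sq_sqrt hy₂
      have hστ : Real.sqrt (x₁ * y₁) = σ * τ := Real.sqrt_mul hx₁ y₁
      have hst : Real.sqrt (x₂ * y₂) = s * t := Real.sqrt_mul hx₂ y₂
      -- g_i ≤ σ τ, s t  and  σ τ < w₁, s t < w₂
      have hgle₁ : r₁ - x₁ - y₁ ≤ σ * τ := by
        rw [← hστ, ← Real.sqrt_sq (show 0 ≤ r₁ - x₁ - y₁ by linarith)]
        exact Real.sqrt_le_sqrt hg₁
      have hgle₂ : r₂ - x₂ - y₂ ≤ s * t := by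
        rw [← hst, ← Real.sqrt_sq (show 0 ≤ r₂ - x₂ - y₂ by linarith)]
        exact Real.sqrt_le_sqrt hg₂
      have hlt₁ : σ * τ < 1 - x₁ - y₁ := by
        rw [← hστ, ← Real.sqrt_sq hw₁]
        exact Real.sqrt_lt_sqrt (mul_nonneg hx₁ hy₁) h1
      have hlt₂ : s * t < 1 - x₂ - y₂ := by
        rw [← hst, ← Real.sqrt_sq hw₂]
        exact Real.sqrt_lt_sqrt (mul_nonneg hx₂ hy₂) h2
      have hm₁ : 0 ≤ 1 - σ^2 - τ^2 - σ*τ := by rw [hσ2, hτ2]; linarith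
      have hm₂ : 0 ≤ 1 - s^2 - t^2 - s*t := by rw [hs2, ht2]; linarith
      have core := geom_compose_core σ τ s t hσ hτ hs ht hm₁ hm₂
      simp only [hσ2, hτ2, hs2, ht2] at core
      -- monotonicity: M ≤ M⋆ (the boundary value)
      have hle₁ : 1 - x₁ - y₁ - σ*τ ≤ 1 - r₁ := by linarith
      have hle₂ : 1 - x₂ - y₂ - s*t ≤ 1 - r₂ := by linarith
      have hm₁' : 0 ≤ 1 - x₁ - y₁ - σ*τ := by linarith
      have hm₂' : 0 ≤ 1 - x₂ - y₂ - s*t := by linarith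
      have hprod : (1 - x₁ - y₁ - σ*τ) * (1 - x₂ - y₂ - s*t) ≤ (1 - r₁) * (1 - r₂) :=
        mul_le_mul hle₁ hle₂ hm₂' hn₁
      have hMstar : ((1 - x₁ - y₁) * (1 - x₂ - y₂) - (1 - r₁) * (1 - r₂) * (1 - (x₁ * y₂ + x₂ * y₁)))
          ≤ (1 - x₁ - y₁) * (1 - x₂ - y₂) - (1 - x₁ - y₁ - σ*τ) * (1 - x₂ - y₂ - s*t) * (1 - (x₁ * y₂ + x₂ * y₁)) := by
        have := mul_le_mul_of_nonneg_right hprod hP0'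
        linarith
      have hMsq' : ((1 - x₁ - y₁) * (1 - x₂ - y₂) - (1 - r₁) * (1 - r₂) * (1 - (x₁ * y₂ + x₂ * y₁)))^2
          ≤ ((1 - x₁ - y₁) * (1 - x₂ - y₂) - (1 - x₁ - y₁ - σ*τ) * (1 - x₂ - y₂ - s*t) * (1 - (x₁ * y₂ + x₂ * y₁)))^2 :=
        pow_le_pow_left₀ hM0 hMstar 2
      exact le_trans hMsq' core

/-! ### Appended (same session): the two remaining closure operations of THEOREM A's toolkit and the passage to APL(2/3)

* `geom_scale` — a pendant apex / apex-edge weight `z ∈ [0,1]` maps `(qB, qC, r) ↦ (z·qB, z·qC, z·r)` and preserves `Γ`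
  (memo §1: `(qB,qC,r)_a = z·(qB,qC,r)_g` for `a` pendant at `g`);
* `apl23_of_geom` — APL-G implies APL(2/3): `(T·D − e)² ≤ u_ab·u_ac ⟹ 2·T·D ≤ 3·e` (AM–GM), the constant conjectured sharp by
  prove-5 g35 and attained in the limit of deep symmetric hub trees. -/

/-- `Γ` is a cone cut by the box: scaling a gadget triple by `z ∈ [0,1]` (pendant apex of weight `z`) keeps it in `Γ`.
[folklore] -/
theorem geom_scale (x y r z : ℝ) (hz₀ : 0 ≤ z) (hz₁ : z ≤ 1) (hx : 0 ≤ x) (hy : 0 ≤ y) (hl : x + y ≤ r)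
    (hr : r ≤ 1) (hg : (r - x - y)^2 ≤ x * y) :
    0 ≤ z * x ∧ 0 ≤ z * y ∧ z * x + z * y ≤ z * r ∧ z * r ≤ 1 ∧ (z * r - z * x - z * y)^2 ≤ (z * x) * (z * y) := by
  refine ⟨mul_nonneg hz₀ hx, mul_nonneg hz₀ hy, by nlinarith [mul_le_mul_of_nonneg_left hl hz₀], ?_, ?_⟩
  · exact mul_le_one₀ hz₁ (by linarith) hr
  · have h1 : (z * r - z * x - z * y)^2 = z^2 * (r - x - y)^2 := by ring
    have h2 : (z * x) * (z * y) = z^2 * (x * y) := by ring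
    rw [h1, h2]
    exact mul_le_mul_of_nonneg_left hg (sq_nonneg z)

/-- APL-G ⟹ APL(2/3): if `(T·D − e)² ≤ u_ab·u_ac` with `e = u_ab + u_ac`, `u_ab, u_ac ≥ 0`, then `2·(T·D) ≤ 3·e`
(since `sqrt(u_ab u_ac) ≤ e/2`).  With `T = P(a↔b ∪ a↔c)`, `D = P(b↮c)` this is the conjectured reverse-Harris row
`P(ab|c) + P(ac|b) ≥ (2/3)·P(b↮c)·P(a↔b ∪ a↔c)`. [folklore] -/
theorem apl23_of_geom (uab uac T D : ℝ) (huab : 0 ≤ uab) (huac : 0 ≤ uac)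
    (h : (T * D - (uab + uac))^2 ≤ uab * uac) : 2 * (T * D) ≤ 3 * (uab + uac) := by
  have h2 : (T * D - (uab + uac))^2 ≤ ((uab + uac) / 2)^2 :=
    le_trans h (by nlinarith [sq_nonneg (uab - uac)])
  have h3 : |T * D - (uab + uac)| ≤ (uab + uac) / 2 := abs_le_of_sq_le_sq h2 (by positivity)
  have h4 := le_abs_self (T * D - (uab + uac))
  linarith

/-! ### Appended (same session): APL-G in cell form and the Gladkov–Zimin conjecture

With the five cells `u0 = P(a|b|c)`, `uab = P(ab|c)`, `uac = P(ac|b)`, `ubc = P(a|bc)`, `u3 = P(abc)` (summing to `1`),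
`T = uab + uac + u3`, `D = u0 + uab + uac`, `e = uab + uac`, the Harris defect is
  `T·D − e = u0·u3 − e·ubc`                                   (`harrisDefect_eq_cells`),
so APL-G reads `P(a|b|c)·P(abc) ≤ [P(ab|c)+P(ac|b)]·P(a|bc) + sqrt(P(ab|c)·P(ac|b))`, and
  `P(abc) − P(ac)·P(bc) = (T·D − e) + uab·P(bc)`             (`gzDefect_eq_cells`, `P(ac) = uac+u3`, `P(bc) = ubc+u3`).
Hence APL-G implies the QUANTITATIVE form of Gladkov–Zimin, *Bond percolation does not simulate site percolation*
(Electron. Commun. Probab. 2026, arXiv:2404.08873) Conjecture 6.3 = Gladkov, arXiv:2408.08457, Conjecture 10.1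
("P(ab|c) < δ ⟹ P(abc) − P(ac)P(bc) < ε"):  `P(abc) − P(ac)P(bc) ≤ sqrt(P(ab|c)P(ac|b)) + P(ab|c)·P(bc) ≤ √δ + δ`
(`gz63_of_geom`).  By THEOREM A / COROLLARY B of the memo this settles the conjecture on every weighted graph with
`G ∖ {b,c}` a forest and reduces it to instances with `G − {a,b,c}` connected. -/

/-- The Harris defect in cells: `T·D − e = P(a|b|c)·P(abc) − [P(ab|c)+P(ac|b)]·P(a|bc)`. [folklore] -/
theorem harrisDefect_eq_cells (u0 uab uac ubc u3 : ℝ) (hsum : u0 + uab + uac + ubc + u3 = 1) :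
    (uab + uac + u3) * (u0 + uab + uac) - (uab + uac) = u0 * u3 - (uab + uac) * ubc := by
  have hubc : ubc = 1 - u0 - uab - uac - u3 := by linarith
  subst hubc
  ring

/-- The Gladkov–Zimin defect in cells: `P(abc) − P(ac)·P(bc) = (T·D − e) + P(ab|c)·P(bc)`. [folklore] -/
theorem gzDefect_eq_cells (u0 uab uac ubc u3 : ℝ) (hsum : u0 + uab + uac + ubc + u3 = 1) :
    u3 - (uac + u3) * (ubc + u3) = ((uab + uac + u3) * (u0 + uab + uac) - (uab + uac)) + uab * (ubc + u3) := by
  have hubc : ubc = 1 - u0 - uab - uac - u3 := by linarith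
  subst hubc
  ring

/-- APL-G ⟹ quantitative Gladkov–Zimin Conjecture 6.3 / Gladkov Conjecture 10.1:
`P(abc) − P(ac)·P(bc) ≤ sqrt(P(ab|c)·P(ac|b)) + P(ab|c)·P(bc)`; in particular `P(ab|c) < δ` forces
`P(abc) − P(ac)P(bc) ≤ √δ + δ`.  (Conditional on APL-G, which is proved here only through the composition lemma;
see the memo for the class on which it is a theorem.) [folklore] -/
theorem gz63_of_geom (u0 uab uac ubc u3 : ℝ) (hsum : u0 + uab + uac + ubc + u3 = 1)
    (h : ((uab + uac + u3) * (u0 + uab + uac) - (uab + uac))^2 ≤ uab * uac) :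
    u3 - (uac + u3) * (ubc + u3) ≤ Real.sqrt (uab * uac) + uab * (ubc + u3) := by
  rw [gzDefect_eq_cells u0 uab uac ubc u3 hsum]
  have h1 : (uab + uac + u3) * (u0 + uab + uac) - (uab + uac) ≤ Real.sqrt (uab * uac) := by
    calc (uab + uac + u3) * (u0 + uab + uac) - (uab + uac)
        ≤ |(uab + uac + u3) * (u0 + uab + uac) - (uab + uac)| := le_abs_self _
      _ = Real.sqrt (((uab + uac + u3) * (u0 + uab + uac) - (uab + uac))^2) := (Real.sqrt_sq_eq_abs _).symm
      _ ≤ Real.sqrt (uab * uac) := Real.sqrt_le_sqrt h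
  linarith

end APL

end Summit.CriticalPhenomena.PercolationContinuityZ3.Theorems
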